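import Summits.Schanuel.Schanuel.Theses.RoyCriterion
import Literature.NumberTheory.Transcendental.TubbsPeriodsIndependence
import Literature.NumberTheory.Transcendental.TubbsPeriodsMain
import Literature.Barriers.Schanuel.NesterenkoModularScopeConjectureProofs
import Literature.Barriers.Schanuel.LargeTranscendenceDegree

-- `Summit.Schanuel.Schanuel.…` is the mandated layout of this single-problem summit (CONVENTIONS §1).
set_option linter.dupNamespace false

/-!
# Route `RoyCriterion`, crux `SchanuelTwo` (stmt-Schanuel-0069), line `CardA_BW` (skeleton v3) — stub
# `stub_periodSector`: the period-rich sector, CONDITIONAL on Tubbs 1990 Thm 4 (§1–§2), discharged in §3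

The crux `Summit.Schanuel.Schanuel.Theses.RoyCriterion.SchanuelTwo` is Schanuel's conjecture for
`n = 2`: for `x : Fin 2 → ℂ` linearly independent over `ℚ`, `2 ≤ trdeg_ℚ K_x` where
`K_x = ℚ(x, e^x) = IntermediateField.adjoin ℚ (range x ∪ range (exp ∘ x))`. Line `CardA_BW`
(crux-ideate r2, ideator 5) is a SECTOR ATLAS for the crux; its skeleton v3 ABSORBS the second line
`CardB_Scale` (idea `cm-level-set-period-scale`, crux-ideate r2 ideator 5, card file `CardB_Scale.lean`)
as the registered stub `stub_periodSector`, the PERIOD-RICH sector, landed here: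

> given the named fact `Literature.NumberTheory.Transcendental.Tubbs1990_thm4_periods`, if a lattice
> basis `ω₁, ω₂` (Mathlib `PeriodPair`), its invariants `g₂, g₃`, a scale `c ≠ 0` and the two numbers
> `e^{cω₁}, e^{cω₂}` are all ALGEBRAIC OVER `K_x`, then `2 ≤ trdeg_ℚ K_x`.

Engine (a HYPOTHESIS `h` of the theorems of §1–§2, which are CONDITIONAL on it, as registered): the
named fact `Tubbs1990_thm4_periods` (R. Tubbs, J. Number Theory 35 (1990), Thm 4 p. 112 and Remark
p. 114; = G. V. Chudnovsky, *Contributions* (1984), Ch. 7 Thm 4.1 (i), p. 318): for every lattice basis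
and every `c ≠ 0`, `2 ≤ trdeg_ℚ ℚ(g₂, g₃, ω₁, ω₂, c, e^{cω₁}, e^{cω₂})`. Proof of the stub: that field
sits inside `K_x(T)`, `T = {g₂, g₃, ω₁, ω₂, c, e^{cω₁}, e^{cω₂}}`, an ALGEBRAIC extension of `K_x`, so
the seven numbers are adjoined at no cost in transcendence degree
(`Literature.Barriers.Schanuel.trdeg_adjoin_union_eq_of_isAlgebraic_adjoin`) and monotonicity
(`Literature.Barriers.Schanuel.trdeg_mono`) finishes. The fact is PROVED in the tree
(`Literature.NumberTheory.Transcendental.Tubbs1990_thm4_periods_holds`, `TubbsPeriodsMain.lean`,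
axioms `propext`/`Classical.choice`/`Quot.sound`), and §3 applies §1–§2 to that proof: the period-rich
sector and the three corollaries hold UNCONDITIONALLY (`two_le_trdeg_SF_periodSector`, `…_holds`).

Contents (sorry-free, no definitions; every "Schanuel field" is written out as
`IntermediateField.adjoin ℚ (range x ∪ range (exp ∘ x))`): §1 `stub_periodSector` — the registered
stub, verbatim; §2 line `CardB_Scale`'s content as conditional corollaries:
`two_le_trdeg_SF_scale` — **self-referential scales settle planes**: `g₂, g₃ ∈ ℚ̄` and `c ≠ 0`
ALGEBRAIC OVER `K = ℚ(cω₁, cω₂, e^{cω₁}, e^{cω₂})` ⟹ `2 ≤ trdeg_ℚ K` (i.e. `SchanuelTwo` at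
`x = c • (ω₁, ω₂)`; `ωᵢ = c⁻¹ · (cωᵢ)` is algebraic over `K`); `two_le_trdeg_SF_period_sq` —
the case `c = ω₁`, `x = (ω₁², ω₁ω₂)`; `two_le_trdeg_SF_log_scale` — the case `e^u = ω₁`,
`x = (u, (ω₂/ω₁)u)` (lemniscatic lattice: two of `log ϖ, ϖ, ϖ^i` are algebraically independent).
§3 the unconditional forms. Relation to the support item `stmt-Schanuel-14661`
(`SchanuelTwoOnPeriodLattices`, landed in `RoyCriterionSchanuelTwoOnPeriodLattices.lean` conditionally
as `schanuelTwoOnPeriodLattices_of_tubbs` and discharged there by the same `Tubbs1990_thm4_periods_holds`):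
that item is the case `c = 1`, `g₂, g₃ ∈ ℚ̄` of `two_le_trdeg_SF_scale`. The sector's complement is NOT
claimed easier (card B).
-/

noncomputable section

open Complex IntermediateField
open Literature.Barriers.Schanuel (trdeg_adjoin_union_eq_of_isAlgebraic_adjoin trdeg_mono)

namespace Summit.Schanuel.Schanuel.Theorems

/-! ### §1 The registered stub: the period-rich sector (conditional) -/

/-- **Stub `stub_periodSector` of line `CardA_BW` (crux `SchanuelTwo`, stmt-Schanuel-0069): the
period-rich sector, CONDITIONAL on the named fact `Tubbs1990_thm4_periods`.** For any pair
`x : Fin 2 → ℂ`: if a lattice basis `ω₁, ω₂`, its invariants `g₂, g₃`, a scale `c ≠ 0` and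
`e^{cω₁}, e^{cω₂}` are all algebraic over `K_x = ℚ(x, e^x)`, then `2 ≤ trdeg_ℚ K_x`. Proof: by the
fact, `2 ≤ trdeg_ℚ ℚ(T)` for `T = {g₂, g₃, ω₁, ω₂, c, e^{cω₁}, e^{cω₂}}`; `ℚ(T) ≤ K_x(T)`
(monotonicity of `trdeg`, `Literature.Barriers.Schanuel.trdeg_mono`), and `K_x(T)` is an algebraic
extension of `K_x`, so `trdeg_ℚ K_x(T) = trdeg_ℚ K_x`
(`Literature.Barriers.Schanuel.trdeg_adjoin_union_eq_of_isAlgebraic_adjoin`).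
[cite: Tubbs1990, Thm 4 (p. 112) and Remark p. 114] -/
theorem stub_periodSector :
    Literature.NumberTheory.Transcendental.Tubbs1990_thm4_periods →
    ∀ (x : Fin 2 → ℂ) (L : PeriodPair) (c : ℂ), c ≠ 0 →
      IsAlgebraic ↥(IntermediateField.adjoin ℚ (Set.range x ∪ Set.range (Complex.exp ∘ x))) L.g₂ →
      IsAlgebraic ↥(IntermediateField.adjoin ℚ (Set.range x ∪ Set.range (Complex.exp ∘ x))) L.g₃ →
      IsAlgebraic ↥(IntermediateField.adjoin ℚ (Set.range x ∪ Set.range (Complex.exp ∘ x))) L.ω₁ →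
      IsAlgebraic ↥(IntermediateField.adjoin ℚ (Set.range x ∪ Set.range (Complex.exp ∘ x))) L.ω₂ →
      IsAlgebraic ↥(IntermediateField.adjoin ℚ (Set.range x ∪ Set.range (Complex.exp ∘ x))) c →
      IsAlgebraic ↥(IntermediateField.adjoin ℚ (Set.range x ∪ Set.range (Complex.exp ∘ x)))
        (Complex.exp (c * L.ω₁)) →
      IsAlgebraic ↥(IntermediateField.adjoin ℚ (Set.range x ∪ Set.range (Complex.exp ∘ x)))
        (Complex.exp (c * L.ω₂)) →
      (2 : Cardinal) ≤ Algebra.trdeg ℚ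
        ↥(IntermediateField.adjoin ℚ (Set.range x ∪ Set.range (Complex.exp ∘ x))) := by
  intro h x L c hc h2 h3 hw1 hw2 hca he1 he2
  set S : Set ℂ := Set.range x ∪ Set.range (Complex.exp ∘ x) with hS
  set T : Set ℂ := {L.g₂, L.g₃, L.ω₁, L.ω₂, c, cexp (c * L.ω₁), cexp (c * L.ω₂)} with hT_def
  have hT : ∀ z ∈ T, IsAlgebraic (adjoin ℚ S) z := by
    intro z hz
    simp only [hT_def, Set.mem_insert_iff, Set.mem_singleton_iff] at hz
    rcases hz with rfl | rfl | rfl | rfl | rfl | rfl | rfl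
    exacts [h2, h3, hw1, hw2, hca, he1, he2]
  have hle : adjoin ℚ T ≤ adjoin ℚ (S ∪ T) := adjoin.mono ℚ _ _ Set.subset_union_right
  calc (2 : Cardinal) ≤ Algebra.trdeg ℚ ↥(adjoin ℚ T) := h L c hc
    _ ≤ Algebra.trdeg ℚ ↥(adjoin ℚ (S ∪ T)) := trdeg_mono hle
    _ = Algebra.trdeg ℚ ↥(adjoin ℚ S) := trdeg_adjoin_union_eq_of_isAlgebraic_adjoin S T hT

/-! ### §2 Line `CardB_Scale`: self-referential scales settle planes (conditional corollaries) -/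

/-- **Self-referential scales settle planes** (line `CardB_Scale`, first lemma), CONDITIONAL on the
named fact `Tubbs1990_thm4_periods`: if `g₂, g₃ ∈ ℚ̄` and the scale `c ≠ 0` is ALGEBRAIC OVER
`K = ℚ(cω₁, cω₂, e^{cω₁}, e^{cω₂})`, then `2 ≤ trdeg_ℚ K`, i.e. `SchanuelTwo` holds at
`x = c • (ω₁, ω₂)` (the support item `stmt-Schanuel-14661` is the case `c = 1`). Proof: the period-rich
sector `stub_periodSector` at `x = (cω₁, cω₂)`: `g₂, g₃` are algebraic over `ℚ ≤ K`, `cωᵢ, e^{cωᵢ} ∈ K`,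
and `ωᵢ` is algebraic over `K` because `c · ωᵢ ∈ K` with `c ≠ 0` algebraic over `K`
(`IsAlgebraic.of_mul`). [cite: Tubbs1990, Thm 4 (p. 112) and Remark p. 114] -/
theorem two_le_trdeg_SF_scale (h : Literature.NumberTheory.Transcendental.Tubbs1990_thm4_periods)
    (L : PeriodPair) (h₂ : IsAlgebraic ℚ L.g₂) (h₃ : IsAlgebraic ℚ L.g₃) (c : ℂ) (hc : c ≠ 0)
    (hcalg : IsAlgebraic
      ↥(IntermediateField.adjoin ℚ (Set.range ![c * L.ω₁, c * L.ω₂] ∪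
        Set.range (Complex.exp ∘ ![c * L.ω₁, c * L.ω₂]))) c) :
    (2 : Cardinal) ≤ Algebra.trdeg ℚ
      ↥(IntermediateField.adjoin ℚ (Set.range ![c * L.ω₁, c * L.ω₂] ∪
        Set.range (Complex.exp ∘ ![c * L.ω₁, c * L.ω₂]))) := by
  set K : IntermediateField ℚ ℂ :=
    adjoin ℚ (Set.range ![c * L.ω₁, c * L.ω₂] ∪ Set.range (Complex.exp ∘ ![c * L.ω₁, c * L.ω₂]))
    with hK
  have hsub : Set.range ![c * L.ω₁, c * L.ω₂] ∪ Set.range (Complex.exp ∘ ![c * L.ω₁, c * L.ω₂]) ⊆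
      (K : Set ℂ) := subset_adjoin ℚ _
  have hy0 : c * L.ω₁ ∈ K := hsub (Or.inl ⟨0, by simp⟩)
  have hy1 : c * L.ω₂ ∈ K := hsub (Or.inl ⟨1, by simp⟩)
  have he0 : cexp (c * L.ω₁) ∈ K := hsub (Or.inr ⟨0, by simp⟩)
  have he1 : cexp (c * L.ω₂) ∈ K := hsub (Or.inr ⟨1, by simp⟩)
  have hcnz : c ∈ nonZeroDivisors ℂ := mem_nonZeroDivisors_of_ne_zero hc
  have hω₁ : IsAlgebraic K L.ω₁ :=
    IsAlgebraic.of_mul hcnz hcalg (isAlgebraic_algebraMap (⟨c * L.ω₁, hy0⟩ : K))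
  have hω₂ : IsAlgebraic K L.ω₂ :=
    IsAlgebraic.of_mul hcnz hcalg (isAlgebraic_algebraMap (⟨c * L.ω₂, hy1⟩ : K))
  exact stub_periodSector h ![c * L.ω₁, c * L.ω₂] L c hc (h₂.tower_top _) (h₃.tower_top _) hω₁ hω₂
    hcalg (isAlgebraic_algebraMap (⟨cexp (c * L.ω₁), he0⟩ : K))
    (isAlgebraic_algebraMap (⟨cexp (c * L.ω₂), he1⟩ : K))

/-- **Instance `c = ω₁`: `SchanuelTwo` at the squared-period plane `(ω₁², ω₁ω₂)`** for a lattice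
basis with `g₂, g₃ ∈ ℚ̄`, CONDITIONAL on the named fact `Tubbs1990_thm4_periods` (the scale `ω₁` is
a square root of `x₀ = ω₁ · ω₁ ∈ K`, hence algebraic over `K`; `ω₁ ≠ 0` as a member of an
`ℝ`-basis).
[cite: Tubbs1990, Thm 4 (p. 112) and Remark p. 114] -/
theorem two_le_trdeg_SF_period_sq
    (h : Literature.NumberTheory.Transcendental.Tubbs1990_thm4_periods) (L : PeriodPair)
    (h₂ : IsAlgebraic ℚ L.g₂) (h₃ : IsAlgebraic ℚ L.g₃) :
    (2 : Cardinal) ≤ Algebra.trdeg ℚ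
      ↥(IntermediateField.adjoin ℚ (Set.range ![L.ω₁ * L.ω₁, L.ω₁ * L.ω₂] ∪
        Set.range (Complex.exp ∘ ![L.ω₁ * L.ω₁, L.ω₁ * L.ω₂]))) := by
  have hω₁ : L.ω₁ ≠ 0 := by simpa using L.indep.ne_zero 0
  refine two_le_trdeg_SF_scale h L h₂ h₃ L.ω₁ hω₁ ?_
  -- `ω₁` is algebraic over `K` since `ω₁ ^ 2 = ω₁ * ω₁ ∈ K`
  set K : IntermediateField ℚ ℂ := adjoin ℚ (Set.range ![L.ω₁ * L.ω₁, L.ω₁ * L.ω₂] ∪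
    Set.range (Complex.exp ∘ ![L.ω₁ * L.ω₁, L.ω₁ * L.ω₂])) with hK
  have hmem : L.ω₁ * L.ω₁ ∈ K := subset_adjoin ℚ _ (Or.inl ⟨0, by simp⟩)
  have hsq : IsAlgebraic K (L.ω₁ ^ 2) := by
    rw [sq]
    exact isAlgebraic_algebraMap (⟨L.ω₁ * L.ω₁, hmem⟩ : K)
  exact IsAlgebraic.of_pow two_pos hsq

/-- **Instance "log scale": `SchanuelTwo` at `(u, (ω₂/ω₁)·u)` whenever `e^u = ω₁`, `u ≠ 0`,** for a
lattice basis with `g₂, g₃ ∈ ℚ̄`, CONDITIONAL on the named fact `Tubbs1990_thm4_periods` (the scale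
`c = u/ω₁` satisfies `c = u · (e^u)⁻¹ ∈ K`, `cω₁ = u`, `cω₂ = (ω₂/ω₁)u`). For the lemniscatic lattice
(`g₃ = 0`, `ω₂/ω₁ = i`): at least two of `log ϖ, ϖ, ϖ^i` are algebraically independent.
[cite: Chudnovsky1984, Ch. 7 Thm 4.1 (i) (p. 318)] -/
theorem two_le_trdeg_SF_log_scale
    (h : Literature.NumberTheory.Transcendental.Tubbs1990_thm4_periods) (L : PeriodPair)
    (h₂ : IsAlgebraic ℚ L.g₂) (h₃ : IsAlgebraic ℚ L.g₃) (u : ℂ) (hu0 : u ≠ 0)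
    (hu : Complex.exp u = L.ω₁) :
    (2 : Cardinal) ≤ Algebra.trdeg ℚ
      ↥(IntermediateField.adjoin ℚ (Set.range ![u, L.ω₂ / L.ω₁ * u] ∪
        Set.range (Complex.exp ∘ ![u, L.ω₂ / L.ω₁ * u]))) := by
  have hω₁ : L.ω₁ ≠ 0 := by simpa using L.indep.ne_zero 0
  set c : ℂ := u / L.ω₁ with hc
  have hc0 : c ≠ 0 := div_ne_zero hu0 hω₁
  have hx0 : c * L.ω₁ = u := by rw [hc]; field_simp
  have hx1 : c * L.ω₂ = L.ω₂ / L.ω₁ * u := by rw [hc]; field_simp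
  have key := two_le_trdeg_SF_scale h L h₂ h₃ c hc0
  rw [hx0, hx1] at key
  refine key ?_
  -- `c = u · (e^u)⁻¹ ∈ K`
  set K : IntermediateField ℚ ℂ := adjoin ℚ (Set.range ![u, L.ω₂ / L.ω₁ * u] ∪
    Set.range (Complex.exp ∘ ![u, L.ω₂ / L.ω₁ * u])) with hK
  have hum : u ∈ K := subset_adjoin ℚ _ (Or.inl ⟨0, by simp⟩)
  have hem : cexp u ∈ K := subset_adjoin ℚ _ (Or.inr ⟨0, by simp⟩)
  have hcm : c ∈ K := by
    rw [hc, ← hu]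
    exact div_mem hum hem
  exact isAlgebraic_algebraMap (⟨c, hcm⟩ : K)

/-! ### §3 Discharge: the named fact is PROVED in the tree, so the sector is unconditional -/

/-- **The period-rich sector, UNCONDITIONALLY**: the registered (conditional) stub
`stub_periodSector` applied to the tree's proof
`Literature.NumberTheory.Transcendental.Tubbs1990_thm4_periods_holds` of the named fact
`Tubbs1990_thm4_periods` (`TubbsPeriodsMain.lean`: Gel'fond's method, Tijdeman's lemma in place of
the zero estimate). For any pair `x`: a lattice basis `ω₁, ω₂`, its invariants `g₂, g₃`, a scale
`c ≠ 0` and `e^{cω₁}, e^{cω₂}` all algebraic over `K_x = ℚ(x, e^x)` ⟹ `2 ≤ trdeg_ℚ K_x`.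
[cite: Tubbs1990, Thm 4 (p. 112) and Remark p. 114] -/
theorem two_le_trdeg_SF_periodSector :
    ∀ (x : Fin 2 → ℂ) (L : PeriodPair) (c : ℂ), c ≠ 0 →
      IsAlgebraic ↥(IntermediateField.adjoin ℚ (Set.range x ∪ Set.range (Complex.exp ∘ x))) L.g₂ →
      IsAlgebraic ↥(IntermediateField.adjoin ℚ (Set.range x ∪ Set.range (Complex.exp ∘ x))) L.g₃ →
      IsAlgebraic ↥(IntermediateField.adjoin ℚ (Set.range x ∪ Set.range (Complex.exp ∘ x))) L.ω₁ →
      IsAlgebraic ↥(IntermediateField.adjoin ℚ (Set.range x ∪ Set.range (Complex.exp ∘ x))) L.ω₂ →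
      IsAlgebraic ↥(IntermediateField.adjoin ℚ (Set.range x ∪ Set.range (Complex.exp ∘ x))) c →
      IsAlgebraic ↥(IntermediateField.adjoin ℚ (Set.range x ∪ Set.range (Complex.exp ∘ x)))
        (Complex.exp (c * L.ω₁)) →
      IsAlgebraic ↥(IntermediateField.adjoin ℚ (Set.range x ∪ Set.range (Complex.exp ∘ x)))
        (Complex.exp (c * L.ω₂)) →
      (2 : Cardinal) ≤ Algebra.trdeg ℚ
        ↥(IntermediateField.adjoin ℚ (Set.range x ∪ Set.range (Complex.exp ∘ x))) :=
  stub_periodSector Literature.NumberTheory.Transcendental.Tubbs1990_thm4_periods_holds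

/-- **Self-referential scales settle planes, UNCONDITIONALLY**: for a lattice basis with
`g₂, g₃ ∈ ℚ̄` and a scale `c ≠ 0` algebraic over `K = ℚ(cω₁, cω₂, e^{cω₁}, e^{cω₂})`,
`2 ≤ trdeg_ℚ K` (`two_le_trdeg_SF_scale` at the tree's proof `Tubbs1990_thm4_periods_holds`).
[cite: Tubbs1990, Thm 4 (p. 112) and Remark p. 114] -/
theorem two_le_trdeg_SF_scale_holds (L : PeriodPair) (h₂ : IsAlgebraic ℚ L.g₂)
    (h₃ : IsAlgebraic ℚ L.g₃) (c : ℂ) (hc : c ≠ 0)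
    (hcalg : IsAlgebraic
      ↥(IntermediateField.adjoin ℚ (Set.range ![c * L.ω₁, c * L.ω₂] ∪
        Set.range (Complex.exp ∘ ![c * L.ω₁, c * L.ω₂]))) c) :
    (2 : Cardinal) ≤ Algebra.trdeg ℚ
      ↥(IntermediateField.adjoin ℚ (Set.range ![c * L.ω₁, c * L.ω₂] ∪
        Set.range (Complex.exp ∘ ![c * L.ω₁, c * L.ω₂]))) :=
  two_le_trdeg_SF_scale Literature.NumberTheory.Transcendental.Tubbs1990_thm4_periods_holds L h₂ h₃
    c hc hcalg

/-- **`SchanuelTwo` at `(ω₁², ω₁ω₂)`, UNCONDITIONALLY**, for every lattice basis with `g₂, g₃ ∈ ℚ̄`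
(`two_le_trdeg_SF_period_sq` at the tree's proof `Tubbs1990_thm4_periods_holds`).
[cite: Tubbs1990, Thm 4 (p. 112) and Remark p. 114] -/
theorem two_le_trdeg_SF_period_sq_holds (L : PeriodPair) (h₂ : IsAlgebraic ℚ L.g₂)
    (h₃ : IsAlgebraic ℚ L.g₃) :
    (2 : Cardinal) ≤ Algebra.trdeg ℚ
      ↥(IntermediateField.adjoin ℚ (Set.range ![L.ω₁ * L.ω₁, L.ω₁ * L.ω₂] ∪
        Set.range (Complex.exp ∘ ![L.ω₁ * L.ω₁, L.ω₁ * L.ω₂]))) :=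
  two_le_trdeg_SF_period_sq Literature.NumberTheory.Transcendental.Tubbs1990_thm4_periods_holds L
    h₂ h₃

/-- **`SchanuelTwo` at `(u, (ω₂/ω₁)·u)` whenever `e^u = ω₁`, `u ≠ 0`, UNCONDITIONALLY**, for every
lattice basis with `g₂, g₃ ∈ ℚ̄` (`two_le_trdeg_SF_log_scale` at the tree's proof
`Tubbs1990_thm4_periods_holds`); e.g. at least two of `log ϖ, ϖ, ϖ^i` are algebraically independent.
[cite: Chudnovsky1984, Ch. 7 Thm 4.1 (i) (p. 318)] -/
theorem two_le_trdeg_SF_log_scale_holds (L : PeriodPair) (h₂ : IsAlgebraic ℚ L.g₂)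
    (h₃ : IsAlgebraic ℚ L.g₃) (u : ℂ) (hu0 : u ≠ 0) (hu : Complex.exp u = L.ω₁) :
    (2 : Cardinal) ≤ Algebra.trdeg ℚ
      ↥(IntermediateField.adjoin ℚ (Set.range ![u, L.ω₂ / L.ω₁ * u] ∪
        Set.range (Complex.exp ∘ ![u, L.ω₂ / L.ω₁ * u]))) :=
  two_le_trdeg_SF_log_scale Literature.NumberTheory.Transcendental.Tubbs1990_thm4_periods_holds L
    h₂ h₃ u hu0 hu

end Summit.Schanuel.Schanuel.Theorems

end
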